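import Summits.HodgeConjecture.CorCM.IrreducibleOddWeightsIsotypicFrobeniusCount
import Summits.HodgeConjecture.CorCM.IrreducibleOddWeightsIsotypicNondegenerate
import HarnessLib

/-!
# Isotypic cells, Frobenius IV: RANKS AND NONDEGENERACY WITH THE MULTIPLICITIES READ OFF THE STABILISER —
# `rank Φ = |E|/2 + 1 ⟺ ∀ c odd, dim D_c⟨b_c⟩ = dim A_c^{Stab(x₀)}`, with no input but the slots

COR-CM (cell `pub-hodgecm2`, binder seat `b16` gen 77, count-neutral claim FROBENIUS RECIPROCITY IN THE REFERENCE
CURRENCY — MULTIPLICITIES FROM FIXED POINTS, file R4 — families of slots and type ranks; theorems only, no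
definition, no named fact, no `sorry`).  NEW as stated, hence under `Summits/`.  HONEST FRAMING: file R3
(`card_mul_finrank_map_applyₗ_eq_finrank_inf`: for a TRANSITIVE slot `Y₀ ∋ x₀` the multiplicity `m_c` of a reference
irreducible `A_c` satisfies `m_c·δ_c = dim A_c^{Stab(x₀)}`) is substituted into the gen 75/76 rank formulas:
the Kubota–Dodson rank `rank Φ_i − 1 = dim Hg(A_{Φ_i}) = Σ_c r^i_c·dim A_c` has `r^i_c·δ_c ≤ m_{i,c}·δ_c =
dim A_c^{H_i}`, and gen 76 E10's nondegeneracy criterion «`r^i_c = m_{i,c}` in every odd class» becomes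
**«the D-span of the class-`c` components of `u_i` has dimension `dim A_c^{H_i}` in every odd class»** — a
statement in which the multiplicities no longer appear.  Nothing about Hodge classes is asserted; `HC_CM` is
neither used nor asserted.

* §1 ONE SLOT: `finrank_iSup_map_applyₗ_le_finrank_inf` — for ANY vector decomposed over the references, the D-span
  of its class-`c₀` components has **`dim ⨆_j 𝒟·b_j ≤ dim A_{c₀}^{Stab(x₀)}`** (gen 72 C4 `≤ |J|·δ` + R3).
* §2 FAMILIES OF CM TYPES (M-series hypotheses): **`typeRank_eq_iff_forall_odd_finrank_eq_finrank_inf`** —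
  `rank Φ_{i₀} = |E_{i₀}|/2 + 1 ⟺ ∀ c` with `A_c` odd, `dim ⨆_j 𝒟_c·b^{i₀}_{c,j} = dim(A_c ⊓ F_c)`, `F_c` the
  fixed subspace of `Stab(x₀)` in `ℚ^{Y_c}` (E10 + R3).
* §3 NO INPUT BUT THE SLOTS: **`exists_isotypic_card_mul_eq_finrank_inf`** — for finite `G`-sets `E_i` there is an
  isotypic decomposition (gen 76 E3) such that for EVERY transitive slot `E_i ∋ x₀` and every class,
  **`m_{i,c}·δ_c = dim(A_c ⊓ F)`** (`F` the fixed subspace of `Stab(x₀)` in `ℚ^{⊔E}`) and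
  `|E_i| = Σ_c (dim(A_c ⊓ F)/δ_c)·dim A_c`; **`exists_isotypic_typeRank_eq_iff_forall_odd_finrank_inf`** — for
  every family of CM types, the criterion of §2 for every transitive member at once.
Sequel R5 `CorCM/IrreducibleOddWeightsIsotypicFrobeniusCMFields`: `Aut(ℂ)` on `Hom(K_i, ℂ)` (one orbit):
`[K_i:ℚ] = Σ_c (dim A_c^{H_i}/δ_c)·dim A_c`, `IsNondegenerate Φ_i ⟺ ∀ c odd, dim D_c⟨b^i_c⟩ = dim A_c^{H_i}`.

## References

* [LangeRodriguez2022] H. Lange, R. E. Rodríguez, *Decomposition of Jacobians by Prym Varieties*, LNM 2310 (2022),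
  §2.8 Lemma 2.8.1.
* [Serre1977] J.-P. Serre, *Linear Representations of Finite Groups*, GTM 42, §2.6, §7.2 Thm. 13.
* [Kubota1965] T. Kubota, *On the field extension by complex multiplication*, Trans. AMS 118 (1965), §2 Lemma 2
  and the criterion p. 115.
* [Mai1989] L. Mai, *Lower bounds for the ranks of CM types*, J. Number Theory 32 (1989), §2 Prop. 1.
* [Deligne1982HodgeCycles] P. Deligne, *Hodge cycles on abelian varieties*, LNM 900 (1982), I Ex. 3.7.
-/

set_option autoImplicit false

noncomputable section

open scoped BigOperators Classical

universe u uC uJ v vC w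

namespace Summit.HodgeConjecture.CorCM.IrrOdd

open Literature.NumberTheory.ComplexMultiplication

variable {G : Type w} [Group G] {ρ : G}

/-! ### §1 One slot: the D-span of the components is bounded by the invariants -/

section OneSlot

variable {Y₀ : Type v} [MulAction G Y₀] [Fintype Y₀] {C : Type uC} [Fintype C] {Yc : C → Type vC}
  [∀ c, MulAction G (Yc c)] [∀ c, Fintype (Yc c)] {Ar : ∀ c, Submodule ℚ (Yc c → ℚ)}
  {JJ : C → Type uJ} [∀ c, Fintype (JJ c)]

/-- **THE D-SPAN OF THE CLASS-`c₀` COMPONENTS OF ANY VECTOR IS BOUNDED BY THE INVARIANTS: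
`dim ⨆_j 𝒟·b_j ≤ dim(A_{c₀} ⊓ F) = dim A_{c₀}^{Stab(x₀)}`** for every `b : J_{c₀} → A_{c₀}` (transitive slot,
isotypic decomposition as in file R3): `dim D⟨b⟩ = r·δ` with `r ≤ |J_{c₀}|` (gen 72 C4) and `|J_{c₀}|·δ =
dim(A_{c₀} ⊓ F)` (R3). [cite: LangeRodriguez2022, §2.8 Lemma 2.8.1] [cite: Serre1977, §2.6] -/
theorem finrank_iSup_map_applyₗ_le_finrank_inf {c₀ : C}
    {𝒟 : Submodule ℚ ((Yc c₀ → ℚ) →ₗ[ℚ] (Yc c₀ → ℚ))}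
    (h𝒟 : ∀ L : (Yc c₀ → ℚ) →ₗ[ℚ] (Yc c₀ → ℚ), L ∈ 𝒟 ↔ (∀ a ∈ Ar c₀, L a ∈ Ar c₀) ∧
      ∀ (k : G) (a : Yc c₀ → ℚ), a ∈ Ar c₀ → L (fun y => a (k • y)) = fun y => L a (k • y))
    (hRst : ∀ c (k : G) (a : Yc c → ℚ), a ∈ Ar c → (fun y => a (k • y)) ∈ Ar c)
    (hRirr : ∀ c (W : Submodule ℚ (Yc c → ℚ)), W ≤ Ar c → W ≠ ⊥ →
      (∀ (k : G) (f : Yc c → ℚ), f ∈ W → (fun y => f (k • y)) ∈ W) → W = Ar c)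
    (hsep : ∀ c c' (L : (Yc c → ℚ) →ₗ[ℚ] (Yc c' → ℚ)), c ≠ c' → Ar c ≠ ⊥ → (∀ a ∈ Ar c, L a ∈ Ar c') →
      (∀ a ∈ Ar c, L a = 0 → a = 0) →
      (∀ (k : G) (a : Yc c → ℚ), a ∈ Ar c → L (fun y => a (k • y)) = fun y => L a (k • y)) → False)
    (ι : ∀ c, JJ c → ((Yc c → ℚ) →ₗ[ℚ] (Y₀ → ℚ)))
    (hιeq : ∀ c (j : JJ c) (k : G) (a : Yc c → ℚ), a ∈ Ar c →
      ι c j (fun y => a (k • y)) = fun y => ι c j a (k • y))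
    (hind₀ : ∀ f : JJ c₀ → (Yc c₀ → ℚ), (∀ j, f j ∈ Ar c₀) → ∑ j, ι c₀ j (f j) = 0 → ∀ j, f j = 0)
    (hindep : iSupIndep fun q : (Σ c, JJ c) => (Ar q.1).map (ι q.1 q.2))
    (htop : (⨆ c, ⨆ j, (Ar c).map (ι c j)) = ⊤)
    {a₀ : Yc c₀ → ℚ} (ha₀ : a₀ ∈ Ar c₀) (h0 : a₀ ≠ 0)
    {x₀ : Y₀} (htr : ∀ x : Y₀, ∃ g : G, g • x₀ = x) {F : Submodule ℚ (Yc c₀ → ℚ)}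
    (hF : ∀ f : Yc c₀ → ℚ, f ∈ F ↔ ∀ k : G, k • x₀ = x₀ → (fun y => f (k • y)) = f)
    {b : JJ c₀ → (Yc c₀ → ℚ)} (hb : ∀ j, b j ∈ Ar c₀) :
    Module.finrank ℚ ↥(⨆ j, 𝒟.map (LinearMap.applyₗ (b j))) ≤ Module.finrank ℚ ↥(Ar c₀ ⊓ F) := by
  obtain ⟨r, hr, hD, -⟩ := exists_rank_finrank_span_shadowCoeff_sum_eq h𝒟 (hRst c₀) (hRirr c₀) (ι c₀) (hιeq c₀)
    hind₀ hb ha₀ h0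
  rw [hD, ← card_mul_finrank_map_applyₗ_eq_finrank_inf h𝒟 hRst hRirr hsep ι hιeq
    (fun j a ha h0' => injOn_of_jointly_independent (ι c₀) hind₀ j a ha h0') hindep htop ha₀ h0 htr hF]
  exact Nat.mul_le_mul_right _ hr

end OneSlot

/-! ### §2 Families of CM types: the nondegeneracy criterion with multiplicities read off the stabiliser -/

section Family

variable {I : Type u} {E : I → Type v} [∀ i, MulAction G (E i)] [∀ i, Fintype (E i)] [Fintype I]
  [∀ i, Nonempty (E i)]
  {C : Type uC} [Fintype C] {Yc : C → Type vC} [∀ c, MulAction G (Yc c)] [∀ c, Fintype (Yc c)]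
  {Ar : ∀ c, Submodule ℚ (Yc c → ℚ)} {𝒟 : ∀ c, Submodule ℚ ((Yc c → ℚ) →ₗ[ℚ] (Yc c → ℚ))}
  {JJ : I → C → Type uJ} [∀ i c, Fintype (JJ i c)]

omit [Fintype I] in
/-- **NONDEGENERACY CLASS BY CLASS, THE MULTIPLICITIES READ OFF THE STABILISER.**  CM types `Φ_i ⊆ E_i` for `ρ`,
the type vectors decomposed over pairwise non-embeddable references `A_c` (`ρ` commuting with the action and
involutive on every `Y_c`), commutants `𝒟_c`, embeddings `ι^i_{c,j}` equivariant and jointly independent on `A_c`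
with, in the slot `E_{i₀}`, independent images spanning `ℚ^{E_{i₀}}`; components `b^i_{c,j} ∈ A_c`, non-zero
`a₀_c ∈ A_c`; the slot `E_{i₀} ∋ x₀` TRANSITIVE, `F_c` the fixed subspace of `Stab(x₀)` in `ℚ^{Y_c}`.  Then
**`rank Φ_{i₀} = |E_{i₀}|/2 + 1 ⟺` for every class `c` with `A_c` ODD, `dim ⨆_j 𝒟_c·b^{i₀}_{c,j} = dim(A_c ⊓ F_c)`**
(gen 76 E10: `⟺ dim D_c⟨b^{i₀}_c⟩ = |J_{i₀,c}|·δ_c`; file R3: `|J_{i₀,c}|·δ_c = dim(A_c ⊓ F_c)`).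
[cite: Kubota1965, §2 (p. 115)] [cite: Mai1989, §2 Prop. 1] [cite: LangeRodriguez2022, §2.8 Lemma 2.8.1] -/
theorem typeRank_eq_iff_forall_odd_finrank_eq_finrank_inf {Φ : ∀ i, Set (E i)} (h : ∀ i, IsCMTypeWith ρ (Φ i))
    (i₀ : I) (hcomm : ∀ c (g : G) (y : Yc c), g • ρ • y = ρ • g • y) (hinv : ∀ c (y : Yc c), ρ • ρ • y = y)
    (h𝒟 : ∀ c (L : (Yc c → ℚ) →ₗ[ℚ] (Yc c → ℚ)), L ∈ 𝒟 c ↔ (∀ a ∈ Ar c, L a ∈ Ar c) ∧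
      ∀ (k : G) (a : Yc c → ℚ), a ∈ Ar c → L (fun y => a (k • y)) = fun y => L a (k • y))
    (hRst : ∀ c (k : G) (a : Yc c → ℚ), a ∈ Ar c → (fun y => a (k • y)) ∈ Ar c)
    (hRirr : ∀ c (W : Submodule ℚ (Yc c → ℚ)), W ≤ Ar c → W ≠ ⊥ →
      (∀ (k : G) (f : Yc c → ℚ), f ∈ W → (fun y => f (k • y)) ∈ W) → W = Ar c)
    (hsep : ∀ c c' (L : (Yc c → ℚ) →ₗ[ℚ] (Yc c' → ℚ)), c ≠ c' → Ar c ≠ ⊥ → (∀ a ∈ Ar c, L a ∈ Ar c') →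
      (∀ a ∈ Ar c, L a = 0 → a = 0) →
      (∀ (k : G) (a : Yc c → ℚ), a ∈ Ar c → L (fun y => a (k • y)) = fun y => L a (k • y)) → False)
    (ι : ∀ i c, JJ i c → ((Yc c → ℚ) →ₗ[ℚ] (E i → ℚ)))
    (hιeq : ∀ i c (j : JJ i c) (k : G) (a : Yc c → ℚ), a ∈ Ar c →
      ι i c j (fun y => a (k • y)) = fun y => ι i c j a (k • y))
    (hind : ∀ i c (f : JJ i c → (Yc c → ℚ)), (∀ j, f j ∈ Ar c) → ∑ j, ι i c j (f j) = 0 → ∀ j, f j = 0)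
    {b : ∀ i c, JJ i c → (Yc c → ℚ)} (hb : ∀ i c j, b i c j ∈ Ar c)
    (hu : ∀ i, antiVec (Φ i) (1 : G) = ∑ c, ∑ j, ι i c j (b i c j))
    {a₀ : ∀ c, Yc c → ℚ} (ha₀ : ∀ c, a₀ c ∈ Ar c) (h0 : ∀ c, a₀ c ≠ 0)
    (hindep : iSupIndep fun q : (Σ c, JJ i₀ c) => (Ar q.1).map (ι i₀ q.1 q.2))
    (htop : (⨆ c, ⨆ j, (Ar c).map (ι i₀ c j)) = ⊤)
    {x₀ : E i₀} (htr : ∀ x : E i₀, ∃ g : G, g • x₀ = x) {F : ∀ c, Submodule ℚ (Yc c → ℚ)}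
    (hF : ∀ c (f : Yc c → ℚ), f ∈ F c ↔ ∀ k : G, k • x₀ = x₀ → (fun y => f (k • y)) = f) :
    typeRank G (Φ i₀) = Fintype.card (E i₀) / 2 + 1 ↔
      ∀ c, Ar c ≤ antiWeights (E := Yc c) ρ →
        Module.finrank ℚ ↥(⨆ j, (𝒟 c).map (LinearMap.applyₗ (b i₀ c j))) = Module.finrank ℚ ↥(Ar c ⊓ F c) := by
  rw [typeRank_eq_iff_forall_odd_finrank_eq h i₀ hcomm hinv h𝒟 hRst hRirr hsep ι hιeq hind hb hu ha₀ h0 htop]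
  refine forall_congr' fun c => forall_congr' fun _ => ?_
  rw [card_mul_finrank_map_applyₗ_eq_finrank_inf (h𝒟 c) hRst hRirr hsep (ι i₀) (hιeq i₀)
    (fun j a ha h0' => injOn_of_jointly_independent (ι i₀ c) (hind i₀ c) j a ha h0') hindep htop (ha₀ c) (h0 c)
    htr (hF c)]

end Family

/-! ### §3 With no input but the slots -/

section NoInput

variable {I : Type u} {E : I → Type v} [∀ i, MulAction G (E i)] [∀ i, Fintype (E i)] [Fintype I]

/-- **THE MULTIPLICITIES OF THE ISOTYPIC DECOMPOSITION ARE READ OFF THE STABILISERS, WITH NO INPUT BUT THE SLOTS.**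
For finite `G`-sets `E_i` (`i ∈ I` finite) there is an isotypic decomposition `ℚ^{E_i} = ⊕_c A_c^{m_{i,c}}` (gen 76
E3: references `A_c ≤ ℚ^{⊔_i E_i}` stable irreducible non-zero pairwise non-embeddable, commutants `𝒟_c`,
equivariant embeddings injective on `A_c` with independent images spanning each slot, non-zero `a₀_c ∈ A_c`) such
that for EVERY slot `E_i` which is TRANSITIVE from a point `x₀` and every class `c`:
**`m_{i,c}·δ_c = dim(A_c ⊓ F)`**, `F` the fixed subspace of `Stab(x₀)` in `ℚ^{⊔_i E_i}` — and consequently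
`|E_i| = Σ_c (dim(A_c ⊓ F)/δ_c)·dim A_c`. [cite: LangeRodriguez2022, §2.8 Lemma 2.8.1]
[cite: Serre1977, §2.6 and §7.2 Thm. 13] -/
theorem exists_isotypic_card_mul_eq_finrank_inf :
    ∃ (n : ℕ) (Ar : Fin n → Submodule ℚ ((Σ i, E i) → ℚ))
      (𝒟 : Fin n → Submodule ℚ (((Σ i, E i) → ℚ) →ₗ[ℚ] ((Σ i, E i) → ℚ))) (m : I → Fin n → ℕ)
      (ι : ∀ (i : I) (c : Fin n), Fin (m i c) → (((Σ i, E i) → ℚ) →ₗ[ℚ] (E i → ℚ)))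
      (a₀ : Fin n → ((Σ i, E i) → ℚ)),
      (∀ (c : Fin n) (L : ((Σ i, E i) → ℚ) →ₗ[ℚ] ((Σ i, E i) → ℚ)), L ∈ 𝒟 c ↔ (∀ a ∈ Ar c, L a ∈ Ar c) ∧
        ∀ (k : G) (a : (Σ i, E i) → ℚ), a ∈ Ar c → L (fun x => a (k • x)) = fun x => L a (k • x)) ∧
      (∀ (c : Fin n) (k : G) (a : (Σ i, E i) → ℚ), a ∈ Ar c → (fun x => a (k • x)) ∈ Ar c) ∧
      (∀ (c : Fin n) (W : Submodule ℚ ((Σ i, E i) → ℚ)), W ≤ Ar c → W ≠ ⊥ →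
        (∀ (k : G) (f : (Σ i, E i) → ℚ), f ∈ W → (fun x => f (k • x)) ∈ W) → W = Ar c) ∧
      (∀ c : Fin n, Ar c ≠ ⊥) ∧
      (∀ (c c' : Fin n) (L : ((Σ i, E i) → ℚ) →ₗ[ℚ] ((Σ i, E i) → ℚ)), c ≠ c' → Ar c ≠ ⊥ →
        (∀ a ∈ Ar c, L a ∈ Ar c') → (∀ a ∈ Ar c, L a = 0 → a = 0) →
        (∀ (k : G) (a : (Σ i, E i) → ℚ), a ∈ Ar c → L (fun x => a (k • x)) = fun x => L a (k • x)) →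
        False) ∧
      (∀ (i : I) (c : Fin n) (j : Fin (m i c)) (k : G) (a : (Σ i, E i) → ℚ), a ∈ Ar c →
        ι i c j (fun x => a (k • x)) = fun s => ι i c j a (k • s)) ∧
      (∀ (i : I) (c : Fin n) (j : Fin (m i c)) (a : (Σ i, E i) → ℚ), a ∈ Ar c → ι i c j a = 0 → a = 0) ∧
      (∀ i : I, iSupIndep fun q : (Σ c : Fin n, Fin (m i c)) => (Ar q.1).map (ι i q.1 q.2)) ∧
      (∀ i : I, (⨆ c : Fin n, ⨆ j : Fin (m i c), (Ar c).map (ι i c j)) = ⊤) ∧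
      (∀ c, a₀ c ∈ Ar c) ∧ (∀ c, a₀ c ≠ 0) ∧
      ∀ (i : I) (x₀ : E i), (∀ x : E i, ∃ g : G, g • x₀ = x) →
        ∀ F : Submodule ℚ ((Σ i, E i) → ℚ),
          (∀ f : (Σ i, E i) → ℚ, f ∈ F ↔ ∀ k : G, k • x₀ = x₀ → (fun y => f (k • y)) = f) →
          (∀ c, m i c * Module.finrank ℚ ↥((𝒟 c).map (LinearMap.applyₗ (a₀ c))) =
            Module.finrank ℚ ↥(Ar c ⊓ F)) ∧
          Fintype.card (E i) = ∑ c, Module.finrank ℚ ↥(Ar c ⊓ F) /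
            Module.finrank ℚ ↥((𝒟 c).map (LinearMap.applyₗ (a₀ c))) * Module.finrank ℚ (Ar c) := by
  obtain ⟨n, Ar, m, ι, hRst, hRirr, hR0, hsep, hιeq, hind, hindep, htop, -⟩ :=
    exists_isotypic_decomposition (G := G) (E := E)
  obtain ⟨𝒟, h𝒟⟩ := exists_commutants (G := G) Ar
  obtain ⟨a₀, ha₀, h0⟩ := exists_mem_ne_zero_of_forall_ne_bot hR0
  have hinj : ∀ (i : I) (c : Fin n) (j : Fin (m i c)) (a : (Σ i, E i) → ℚ), a ∈ Ar c → ι i c j a = 0 → a = 0 :=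
    fun i c j a ha hz => injOn_of_jointly_independent (ι i c) (hind i c) j a ha hz
  refine ⟨n, Ar, 𝒟, m, ι, a₀, h𝒟, hRst, hRirr, hR0, hsep, hιeq, hinj, hindep, htop, ha₀, h0,
    fun i x₀ htr F hF => ⟨fun c => ?_, ?_⟩⟩
  · have h1 := card_mul_finrank_map_applyₗ_eq_finrank_inf (Yc := fun _ : Fin n => Σ i, E i)
      (JJ := fun c => Fin (m i c)) (h𝒟 c) hRst hRirr hsep (ι i) (hιeq i) (hinj i c) (hindep i) (htop i) (ha₀ c)
      (h0 c) htr hF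
    simpa only [Fintype.card_fin] using h1
  · exact card_eq_sum_finrank_inf_div_mul_finrank (Yc := fun _ : Fin n => Σ i, E i)
      (JJ := fun c => Fin (m i c)) h𝒟 hRst hRirr hsep (ι i) (hιeq i) (hinj i) (hindep i) (htop i) ha₀ h0 htr
      (F := fun _ => F) fun _ => hF

variable [∀ i, Nonempty (E i)]

/-- **NONDEGENERACY CLASS BY CLASS WITH THE MULTIPLICITIES READ OFF THE STABILISERS, NO INPUT BUT THE TYPES.**
For every family of CM types `Φ_i ⊆ E_i` for `ρ` there is an isotypic decomposition of the type vectors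
(references `A_c ≤ ℚ^{⊔_i E_i}`, commutants `𝒟_c`, multiplicities `m_{i,c}`, embeddings, components `b^i_{c,j}`,
non-zero `a₀_c`; gen 76 E3) such that for EVERY member whose slot `E_i` is TRANSITIVE from a point `x₀`:
**`rank Φ_i = |E_i|/2 + 1 ⟺ ∀ c` with `A_c` ODD, `dim ⨆_j 𝒟_c·b^i_{c,j} = dim(A_c ⊓ F)`**, `F` the fixed
subspace of `Stab(x₀)` in `ℚ^{⊔_i E_i}` — the components of every odd class span, over `𝒟_c`, a subspace of the
dimension of the invariants. [cite: Kubota1965, §2 (p. 115)] [cite: Mai1989, §2 Prop. 1]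
[cite: LangeRodriguez2022, §2.8 Lemma 2.8.1] -/
theorem exists_isotypic_typeRank_eq_iff_forall_odd_finrank_inf {Φ : ∀ i, Set (E i)}
    (h : ∀ i, IsCMTypeWith ρ (Φ i)) :
    ∃ (n : ℕ) (Ar : Fin n → Submodule ℚ ((Σ i, E i) → ℚ))
      (𝒟 : Fin n → Submodule ℚ (((Σ i, E i) → ℚ) →ₗ[ℚ] ((Σ i, E i) → ℚ))) (m : I → Fin n → ℕ)
      (ι : ∀ (i : I) (c : Fin n), Fin (m i c) → (((Σ i, E i) → ℚ) →ₗ[ℚ] (E i → ℚ)))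
      (b : ∀ (i : I) (c : Fin n), Fin (m i c) → ((Σ i, E i) → ℚ)) (a₀ : Fin n → ((Σ i, E i) → ℚ)),
      (∀ (c : Fin n) (L : ((Σ i, E i) → ℚ) →ₗ[ℚ] ((Σ i, E i) → ℚ)), L ∈ 𝒟 c ↔ (∀ a ∈ Ar c, L a ∈ Ar c) ∧
        ∀ (k : G) (a : (Σ i, E i) → ℚ), a ∈ Ar c → L (fun x => a (k • x)) = fun x => L a (k • x)) ∧
      (∀ (c : Fin n) (k : G) (a : (Σ i, E i) → ℚ), a ∈ Ar c → (fun x => a (k • x)) ∈ Ar c) ∧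
      (∀ (c : Fin n) (W : Submodule ℚ ((Σ i, E i) → ℚ)), W ≤ Ar c → W ≠ ⊥ →
        (∀ (k : G) (f : (Σ i, E i) → ℚ), f ∈ W → (fun x => f (k • x)) ∈ W) → W = Ar c) ∧
      (∀ c : Fin n, Ar c ≠ ⊥) ∧
      (∀ (c c' : Fin n) (L : ((Σ i, E i) → ℚ) →ₗ[ℚ] ((Σ i, E i) → ℚ)), c ≠ c' → Ar c ≠ ⊥ →
        (∀ a ∈ Ar c, L a ∈ Ar c') → (∀ a ∈ Ar c, L a = 0 → a = 0) →
        (∀ (k : G) (a : (Σ i, E i) → ℚ), a ∈ Ar c → L (fun x => a (k • x)) = fun x => L a (k • x)) →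
        False) ∧
      (∀ (i : I) (c : Fin n) (j : Fin (m i c)) (k : G) (a : (Σ i, E i) → ℚ), a ∈ Ar c →
        ι i c j (fun x => a (k • x)) = fun s => ι i c j a (k • s)) ∧
      (∀ (i : I) (c : Fin n) (f : Fin (m i c) → ((Σ i, E i) → ℚ)), (∀ j, f j ∈ Ar c) →
        ∑ j, ι i c j (f j) = 0 → ∀ j, f j = 0) ∧
      (∀ i c j, b i c j ∈ Ar c) ∧ (∀ i, antiVec (Φ i) (1 : G) = ∑ c, ∑ j, ι i c j (b i c j)) ∧
      (∀ c, a₀ c ∈ Ar c) ∧ (∀ c, a₀ c ≠ 0) ∧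
      ∀ (i : I) (x₀ : E i), (∀ x : E i, ∃ g : G, g • x₀ = x) →
        ∀ F : Submodule ℚ ((Σ i, E i) → ℚ),
          (∀ f : (Σ i, E i) → ℚ, f ∈ F ↔ ∀ k : G, k • x₀ = x₀ → (fun y => f (k • y)) = f) →
          (typeRank G (Φ i) = Fintype.card (E i) / 2 + 1 ↔
            ∀ c, Ar c ≤ antiWeights (E := Σ i, E i) ρ →
              Module.finrank ℚ ↥(⨆ j, (𝒟 c).map (LinearMap.applyₗ (b i c j))) =
                Module.finrank ℚ ↥(Ar c ⊓ F)) := by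
  obtain ⟨n, Ar, m, ι, hRst, hRirr, hR0, hsep, hιeq, hind, hindep, htop, hdec⟩ :=
    exists_isotypic_decomposition (G := G) (E := E)
  obtain ⟨𝒟, h𝒟⟩ := exists_commutants (G := G) Ar
  obtain ⟨a₀, ha₀, h0⟩ := exists_mem_ne_zero_of_forall_ne_bot hR0
  obtain ⟨b, hb, hu⟩ := hdec fun i => antiVec (Φ i) (1 : G)
  -- `ρ` commutes with the slotwise action and is involutive on `⊔_i E_i`
  have hcomm : ∀ (g : G) (y : Σ i, E i), g • ρ • y = ρ • g • y := by
    rintro g ⟨i, s⟩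
    change (⟨i, g • ρ • s⟩ : Σ i, E i) = ⟨i, ρ • g • s⟩
    rw [(h i).comm g s]
  have hinv : ∀ y : Σ i, E i, ρ • ρ • y = y := by
    rintro ⟨i, s⟩
    change (⟨i, ρ • ρ • s⟩ : Σ i, E i) = ⟨i, s⟩
    rw [(h i).invol s]
  refine ⟨n, Ar, 𝒟, m, ι, b, a₀, h𝒟, hRst, hRirr, hR0, hsep, hιeq, hind, hb, hu, ha₀, h0,
    fun i x₀ htr F hF => ?_⟩
  exact typeRank_eq_iff_forall_odd_finrank_eq_finrank_inf (Yc := fun _ : Fin n => Σ i, E i)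
    (JJ := fun i c => Fin (m i c)) h i (fun _ => hcomm) (fun _ => hinv) h𝒟 hRst hRirr hsep ι hιeq hind hb hu
    ha₀ h0 (hindep i) (htop i) htr (F := fun _ => F) fun _ => hF

end NoInput

end Summit.HodgeConjecture.CorCM.IrrOdd

end
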